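import Summits.NavierStokesRegularity.NavierStokesRegularity.Theses.TypeICertificateLadder
import Summits.NavierStokesRegularity.NavierStokesRegularity.Theses.SymmetryModuliCount
import Summits.NavierStokesRegularity.NavierStokesRegularity.Theorems.TypeICertificateLadderTargetSolitonBridge
import Summits.NavierStokesRegularity.NavierStokesRegularity.Theorems.TypeICertificateLadderTargetSolitonBridgeOrbit
import Summits.NavierStokesRegularity.NavierStokesRegularity.Theorems.TypeICertificateLadderTargetSolitonBridgeNormalForm
import Summits.NavierStokesRegularity.NavierStokesRegularity.Theorems.TypeICertificateLadderTargetSolitonReduction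
import Summits.NavierStokesRegularity.NavierStokesRegularity.Theorems.SymmetryModuliCountSymmetricLiouvilleCore
import Literature.Analysis.FluidPDE.PineauVicolRSS
import Literature.Analysis.FluidPDE.TypeIAncientMild
import Literature.Analysis.FluidPDE.TypeIAncientMildClassical
import Literature.Analysis.FluidPDE.SwirlTransportProofs
import HarnessLib

/-!
# Crux `Target` ≡ `NoTypeIBlowup` (stmt-NavierStokesRegularity-1217), line `killing-twisted-bernoulli-solitons`:
# the line's open window stub B5b IS the sibling crux `SymmetricLiouville` (stmt-4053) — kernel-checked

Lead `prover-line-stmt-NavierStokesRegularity-1217-c3-0` (continuation lead c3), 2026-08-16.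

`TypeICertificateLadderTargetSolitonBridge.lean` proved one direction: soliton Liouville in Pineau–Vicol's
class (all `α`) — hence the registered window stub B5b `stub_windowLiouville` — FOLLOWS from
`SymmetryModuliCount.SymmetricLiouville` (and from `ExtremalTypeIConstant.SpiralScalingLiouville`). This file
proves the CONVERSE and records the equivalences:

* `solitonBridge_coreTypeI_of_rssLiouville` — soliton Liouville in P–V's class (classical on `[−1,0)`, apex
  bound, `u = pvAnsatz α U`, `U ∈ C²`; all `α`, all `C₀ > 0`) implies the OPEN CORE of stmt-4053 in its Type-I
  form (`SymmetryModuliCountSymmetricLiouville.core_iff_coreTypeI`): every rate-class element annihilated by a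
  spiral-scaling generator `∇u·(x + Ax) + u + 2t∂ₜu − Au`, `A ≠ 0` skew, with an apex bound, vanishes. Route:
  axis normal form (`solitonBridge_axisNormalForm`: conjugate by a linear isometry so that `A` becomes `−2αJ`,
  `α ≠ 0`; the class, the apex bound and the clause are covariant), orbit integration
  (`solitonBridge_pvAnsatz_of_generator`: the clause everywhere makes the field the P–V ansatz of its `t = −1`
  slice), the KNSS pressure (`IsTypeIAncientMild.exists_isClassicalNSSolutionOn_Ioo`: rate-class elements are
  classical on `(−2, 0)`), and the hypothesis;
* `solitonBridge_symmetricLiouville_of_rssLiouville` — hence stmt-4053 itself (its far-field / Oseen-bootstrap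
  reductions `symmetricLiouville_iff_core`, `core_iff_coreTypeI` are tree theorems of that route);
* `solitonBridge_symmetricLiouville_iff_rssLiouville` — **`SymmetricLiouville` ⇔ Pineau–Vicol's Conjecture 1.1
  in their class, all `α`** (the B-side programme of this line);
* `solitonBridge_windowLiouville_iff_symmetricLiouville` — **B5b VERBATIM ⇔ `SymmetricLiouville`**: with the
  tree's Theorem 1.4 and the landed B1–B4, the window statement is equivalent to the all-`α` statement
  (`rssLiouville_of_windowLiouville`, p107094), hence to stmt-4053.

Consequence (census of the line, kernel-checked): the two open stubs of `killing-twisted-bernoulli-solitons` are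
A2' ⇔ rate-class Liouville modulo B5b (`solitonBridge_solitonSelection_iff_rateClassLiouville`) and
B5b ⇔ stmt-4053; since `TypeIAncientLiouville` (4050) ⇔ `ForcedSymmetry` (4052) ∧ `SymmetricLiouville` (4053)
on route `SymmetryModuliCount`, the residual of crux 1217 on this line is EXACTLY that route's pair of cruxes.
CONDITIONAL statements only (both sides open); nothing here closes stmt-1217 or stmt-4053. No definitions.
-/

noncomputable section

set_option linter.dupNamespace false

namespace Summit.NavierStokesRegularity.NavierStokesRegularity.Theorems

open Set Function
open scoped RealInnerProductSpace
open Literature.Analysis.FluidPDE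

/-- The Pineau–Vicol ansatz of the zero profile is the zero field. [folklore] -/
theorem solitonBridge_pvAnsatz_zero_profile (α t : ℝ) (x : EuclideanSpace ℝ (Fin 3)) :
    pvAnsatz α (fun (_ : EuclideanSpace ℝ (Fin 3)) (_ : ℝ) => (0 : EuclideanSpace ℝ (Fin 3))) t x = 0 := by
  simp only [pvAnsatz]
  have h : rotZ (α * -Real.log (-t)) (0 : EuclideanSpace ℝ (Fin 3)) = 0 := by
    simpa only [rotZL_apply] using (rotZL (α * -Real.log (-t))).map_zero
  rw [h, smul_zero]

/-- A field with an apex bound of non-positive constant vanishes on `t < 0`. [folklore] -/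
theorem solitonBridge_eq_zero_of_hasTypeIDecay_nonpos {K : ℝ} (hK : K ≤ 0)
    {v : ℝ → EuclideanSpace ℝ (Fin 3) → EuclideanSpace ℝ (Fin 3)} (hdec : HasTypeIDecay K v) :
    ∀ t < 0, ∀ x, v t x = 0 := by
  intro t ht x
  have hden : 0 < ‖x‖ + Real.sqrt (-t) := by
    have : 0 < Real.sqrt (-t) := Real.sqrt_pos.2 (by linarith)
    positivity
  exact norm_le_zero_iff.1 ((hdec t ht x).trans (div_nonpos_of_nonpos_of_nonneg hK hden.le))

/-- **Soliton Liouville in Pineau–Vicol's class implies the open core of `SymmetricLiouville` (Type-I form).**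
If every classical Type-I RSS solution of P–V's class is trivial (all `α`, all `C₀ > 0`), then every element `u`
of the rate class `A_C` annihilated on `t < 0` by a spiral-scaling generator `∇u·(x + Ax) + u + 2t∂ₜu − Au` with
`A ≠ 0` skew and obeying an apex bound `‖u(t,x)‖ ≤ K/(‖x‖ + √−t)` vanishes on `t < 0`. Proof: put the axis
vertical (`solitonBridge_axisNormalForm`), integrate the clause (`solitonBridge_pvAnsatz_of_generator`: the
conjugated field `v` is `pvAnsatz α (v(−1,·))` on `t < 0`), make `v` classical on `[−1, 0)` with the KNSS pressure
(`IsTypeIAncientMild.exists_isClassicalNSSolutionOn_Ioo`), and apply the hypothesis with `C₀ := K` (if `K ≤ 0`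
the apex bound already kills `v`); `v(−1,·) = 0` makes `v`, hence `u`, vanish. [cite: PineauVicol2026, Conjecture 1.1 and Remark 1.2 (arXiv:2607.09619 pp. 3–4)] -/
theorem solitonBridge_coreTypeI_of_rssLiouville
    (hL : ∀ C₀ : ℝ, 0 < C₀ → ∀ (α : ℝ) (u : ℝ → EuclideanSpace ℝ (Fin 3) → EuclideanSpace ℝ (Fin 3)) (p : ℝ → EuclideanSpace ℝ (Fin 3) → ℝ) (U : EuclideanSpace ℝ (Fin 3) → EuclideanSpace ℝ (Fin 3)), Literature.Analysis.FluidPDE.IsClassicalNSSolutionOn (Set.Ico (-1) 0) 1 0 u p → (∀ t ∈ Set.Ico (-1 : ℝ) 0, ∀ x : EuclideanSpace ℝ (Fin 3), ‖u t x‖ ≤ C₀ / (‖x‖ + Real.sqrt (-t))) → ContDiff ℝ 2 U → (∀ t ∈ Set.Ico (-1 : ℝ) 0, ∀ x : EuclideanSpace ℝ (Fin 3), u t x = Literature.Analysis.FluidPDE.pvAnsatz α (fun y _ => U y) t x) → U = 0) :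
    ∀ (C : ℝ) (u : ℝ → EuclideanSpace ℝ (Fin 3) → EuclideanSpace ℝ (Fin 3)), IsTypeIAncientMild C u →
      ∀ A : EuclideanSpace ℝ (Fin 3) →L[ℝ] EuclideanSpace ℝ (Fin 3), (∀ x, inner ℝ (A x) x = 0) → A ≠ 0 →
        (∀ t < 0, ∀ x, fderiv ℝ (u t) x (x + A x) + u t x + (2 * t) • timeDeriv u t x - A (u t x) = 0) →
        (∃ K : ℝ, HasTypeIDecay K u) → ∀ t < 0, ∀ x, u t x = 0 := by
  intro C u hu A hA hA0 hgen hK t ht x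
  obtain ⟨K, hK⟩ := hK
  obtain ⟨L, α, _hα, hv, hdec, hgenv⟩ := solitonBridge_axisNormalForm C K u A hu hA hA0 hgen hK
  set v : ℝ → EuclideanSpace ℝ (Fin 3) → EuclideanSpace ℝ (Fin 3) := fun t x => L (u t (L.symm x))
    with hv_def
  -- it suffices to kill the conjugated field
  suffices hzero : ∀ s < 0, ∀ y, v s y = 0 by
    have h := hzero t ht (L x)
    simp only [hv_def, LinearIsometryEquiv.symm_apply_apply] at h
    simpa using congrArg L.symm h
  by_cases hKpos : 0 < K
  swap
  · exact solitonBridge_eq_zero_of_hasTypeIDecay_nonpos (not_lt.1 hKpos) hdec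
  -- the conjugated field is the RSS ansatz of its slice at `t = -1`
  have hans : ∀ s < 0, ∀ y, v s y = pvAnsatz α (fun z _ => v (-1) z) s y :=
    solitonBridge_pvAnsatz_of_generator C α v hv hgenv
  -- classical on `[-1, 0)` with the KNSS pressure
  obtain ⟨q, hq⟩ := hv.exists_isClassicalNSSolutionOn_Ioo (show (-2 : ℝ) < 0 by norm_num)
  have hcl : IsClassicalNSSolutionOn (Ico (-1) 0) 1 0 v q :=
    hq.mono (Ico_subset_Ioo_left (by norm_num)) (uniqueDiffOn_Ico _ _)
  have hI : ∀ s ∈ Ico (-1 : ℝ) 0, ∀ y : EuclideanSpace ℝ (Fin 3),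
      ‖v s y‖ ≤ K / (‖y‖ + Real.sqrt (-s)) := fun s hs y => hdec s hs.2 y
  have hU : ContDiff ℝ 2 (fun z => v (-1) z) :=
    contDiff_infty.1 (hv.contDiff_slice (by norm_num : (-1 : ℝ) < 0)) 2
  have hU0 : (fun z => v (-1) z) = 0 :=
    hL K hKpos α v q (fun z => v (-1) z) hcl hI hU (fun s hs y => hans s hs.2 y)
  have hprof0 : (fun (z : EuclideanSpace ℝ (Fin 3)) (_ : ℝ) => v (-1) z) =
      fun (_ : EuclideanSpace ℝ (Fin 3)) (_ : ℝ) => (0 : EuclideanSpace ℝ (Fin 3)) := by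
    funext z r
    exact congrFun hU0 z
  intro s hs y
  rw [hans s hs y, hprof0]
  exact solitonBridge_pvAnsatz_zero_profile α s y

/-- **`SymmetricLiouville` (stmt-NavierStokesRegularity-4053) from soliton Liouville in Pineau–Vicol's class**:
the previous theorem feeds the tree reductions of route `SymmetryModuliCount`
(`core_iff_coreTypeI`: the Oseen bootstrap trades the apex bound for far-field smallness;
`symmetricLiouville_iff_core`: the Killing leaves are proved items). CONDITIONAL on the hypothesis (open:
its window `α ≈ 1` is P–V Conj. 1.1). [cite: PineauVicol2026, Conjecture 1.1 (arXiv:2607.09619 p. 3)] -/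
theorem solitonBridge_symmetricLiouville_of_rssLiouville
    (hL : ∀ C₀ : ℝ, 0 < C₀ → ∀ (α : ℝ) (u : ℝ → EuclideanSpace ℝ (Fin 3) → EuclideanSpace ℝ (Fin 3)) (p : ℝ → EuclideanSpace ℝ (Fin 3) → ℝ) (U : EuclideanSpace ℝ (Fin 3) → EuclideanSpace ℝ (Fin 3)), Literature.Analysis.FluidPDE.IsClassicalNSSolutionOn (Set.Ico (-1) 0) 1 0 u p → (∀ t ∈ Set.Ico (-1 : ℝ) 0, ∀ x : EuclideanSpace ℝ (Fin 3), ‖u t x‖ ≤ C₀ / (‖x‖ + Real.sqrt (-t))) → ContDiff ℝ 2 U → (∀ t ∈ Set.Ico (-1 : ℝ) 0, ∀ x : EuclideanSpace ℝ (Fin 3), u t x = Literature.Analysis.FluidPDE.pvAnsatz α (fun y _ => U y) t x) → U = 0) :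
    Summit.NavierStokesRegularity.NavierStokesRegularity.Theses.SymmetryModuliCount.SymmetricLiouville :=
  SymmetryModuliCountSymmetricLiouville.symmetricLiouville_iff_core.2
    (SymmetryModuliCountSymmetricLiouville.core_iff_coreTypeI.2 (solitonBridge_coreTypeI_of_rssLiouville hL))

/-- **`SymmetricLiouville` (stmt-4053) ⇔ Pineau–Vicol's Conjecture 1.1 in their class, all `α`.** The crux
"continuous symmetry is free" of route `SymmetryModuliCount` and the B-side programme of this line
(Liouville for classical Type-I rotated self-similar solutions on `[−1,0)` with apex bound and `C²` profile,
every rotation rate) are the SAME statement: `→` is `solitonBridge_rssLiouville_of_symmetricLiouville`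
(embedding + generator), `←` is `solitonBridge_symmetricLiouville_of_rssLiouville` (normal form + orbit
integration + KNSS pressure + the route's Oseen bootstrap). [cite: PineauVicol2026, Conjecture 1.1 (arXiv:2607.09619 p. 3)] -/
theorem solitonBridge_symmetricLiouville_iff_rssLiouville :
    Summit.NavierStokesRegularity.NavierStokesRegularity.Theses.SymmetryModuliCount.SymmetricLiouville ↔
      ∀ C₀ : ℝ, 0 < C₀ → ∀ (α : ℝ) (u : ℝ → EuclideanSpace ℝ (Fin 3) → EuclideanSpace ℝ (Fin 3)) (p : ℝ → EuclideanSpace ℝ (Fin 3) → ℝ) (U : EuclideanSpace ℝ (Fin 3) → EuclideanSpace ℝ (Fin 3)), Literature.Analysis.FluidPDE.IsClassicalNSSolutionOn (Set.Ico (-1) 0) 1 0 u p → (∀ t ∈ Set.Ico (-1 : ℝ) 0, ∀ x : EuclideanSpace ℝ (Fin 3), ‖u t x‖ ≤ C₀ / (‖x‖ + Real.sqrt (-t))) → ContDiff ℝ 2 U → (∀ t ∈ Set.Ico (-1 : ℝ) 0, ∀ x : EuclideanSpace ℝ (Fin 3), u t x = Literature.Analysis.FluidPDE.pvAnsatz α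 (fun y _ => U y) t x) → U = 0 :=
  ⟨solitonBridge_rssLiouville_of_symmetricLiouville, solitonBridge_symmetricLiouville_of_rssLiouville⟩

/-- **B5b VERBATIM ⇔ `SymmetricLiouville` (stmt-4053)** (registered stub of the lead's DAG programme). The
registered signature of the line's open window stub `stub_windowLiouville` — Type-I RSS solitons of
Pineau–Vicol's class with rotation rate in a compact window `a₀ ≤ |α| ≤ A₀`, carrying a rotating conjugate
density with the soliton law and identity, are trivial — is EQUIVALENT to the sibling crux
`SymmetryModuliCount.SymmetricLiouville`: `→` through `rssLiouville_of_windowLiouville` (p107094: the tree's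
Theorem 1.4 of Pineau–Vicol and the landed stubs B1–B4 reduce all `α` to the window) and
`solitonBridge_symmetricLiouville_of_rssLiouville`; `←` through
`solitonBridge_rssLiouville_of_symmetricLiouville` (the extra window hypotheses are not needed). Both sides are
OPEN (P–V Conj. 1.1 at `α ≈ 1`); this closes neither item. [cite: PineauVicol2026, Conjecture 1.1 and Theorem 1.4 (arXiv:2607.09619 pp. 3–4)] -/
theorem solitonBridge_windowLiouville_iff_symmetricLiouville :
    (∀ C₀ : ℝ, 0 < C₀ → ∀ a₀ A₀ : ℝ, 0 < a₀ → a₀ ≤ A₀ → ∀ α : ℝ, a₀ ≤ |α| → |α| ≤ A₀ → ∀ (u : ℝ → EuclideanSpace ℝ (Fin 3) → EuclideanSpace ℝ (Fin 3)) (p : ℝ → EuclideanSpace ℝ (Fin 3) → ℝ) (U : EuclideanSpace ℝ (Fin 3) → EuclideanSpace ℝ (Fin 3)) (m : EuclideanSpace ℝ (Fin 3) → ℝ) (c M₁ : ℝ), Literature.Analysis.FluidPDE.IsClassicalNSSolutionOn (Set.Ico (-1) 0) 1 0 u p → (∀ t ∈ Set.Ico (-1 : ℝ) 0, ∀ x :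 EuclideanSpace ℝ (Fin 3), ‖u t x‖ ≤ C₀ / (‖x‖ + Real.sqrt (-t))) → ContDiff ℝ 2 U → (∀ t ∈ Set.Ico (-1 : ℝ) 0, ∀ x : EuclideanSpace ℝ (Fin 3), u t x = Literature.Analysis.FluidPDE.pvAnsatz α (fun y _ => U y) t x) → 0 < c → 0 < M₁ → (ContDiff ℝ 2 m ∧ (∀ y, 0 < m y) ∧ (∫ y, m y = 1) ∧ (∀ y, c * Real.exp (-(7 / 16 : ℝ) * ‖y‖ ^ 2) ≤ m y) ∧ (∀ y, m y ≤ M₁ * Real.exp (-(1 / 16 : ℝ) * ‖y‖ ^ 2)) ∧ (∃ M₂ : ℝ, ∀ y, ‖fderiv ℝ m y‖ ≤ M₂ * Real.exp (-(1 / 32 : ℝ) * ‖y‖ ^ 2)) ∧ (∀ y, Laplacian.laplacian m y + Literature.Analysis.FluidPDE.VectorCalculus.divergence (fun z => m z • (U z + (1 / 2 : ℝ) • z - α • Literature.Analysis.FluidPDE.rotGen z)) y = 0)) → (∫ y, ‖Literature.Analysis.FluidPDE.curl U y‖ ^ 2 * m y ≤ 4 * α ^ 2) → (∫ y, ‖Literature.Analysis.FluidPDE.curl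 U y‖ ^ 2 * m y = 2 * α * ∫ y, (Literature.Analysis.FluidPDE.curl U y) 2 * m y) → U = 0) ↔
    Summit.NavierStokesRegularity.NavierStokesRegularity.Theses.SymmetryModuliCount.SymmetricLiouville := by
  constructor
  · intro h5
    exact solitonBridge_symmetricLiouville_of_rssLiouville (rssLiouville_of_windowLiouville h5)
  · intro h4053 C₀ hC₀ a₀ A₀ _ _ α _ _ u p U m c M₁ hsol hI hU hA _ _ _ _ _
    exact solitonBridge_rssLiouville_of_symmetricLiouville h4053 C₀ hC₀ α u p U hsol hI hU hA

end Summit.NavierStokesRegularity.NavierStokesRegularity.Theorems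

end
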